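import Summits.Ventures.LatticeQCDFlow.Exactness.FlowSamplerSymmetrisationDirichlet
import Summits.Ventures.LatticeQCDFlow.Exactness.FlowSamplerOddObservableExact
import Summits.Ventures.LatticeQCDFlow.Exactness.IMHVariationalPrinciple
import HarnessLib

/-!
# Parity decomposition under a symmetric proposal: `C_g(n) = C_{g₊}(n) + C_{g₋}(n)` and `τ(g)·Var g = τ(g₊)·Var g₊ + τ(g₋)·Var g₋` — so the SYMMETRISED flow sampler never makes any observable slower than the raw flow's slowest parity component of it

HONEST FRAMING: exact (Metropolis-corrected) sampling algorithms for lattice gauge theory;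
figures of merit are autocorrelation/cost numbers at stated couplings and volumes; no
continuum-physics claim.  (SCALAR calibration rung S0-A: not a gauge result.)

Venture `LatticeQCDFlow` (cell pub-lqcd), topic `Exactness`; FANOUT row 2 (`s0-phi4`, FLOW arm).  NEW
WORK of the cell, the mechanism behind gen-22's parity theorems (`FlowSamplerSymmetrisationDirichlet`:
`τ^{q̃ₛ}(g) ≤ τ^{q̃}(g)` for EVEN or ODD `g`) and behind the mixed-parity counterexample
(`FlowSamplerSymmetrisationMixedParity`: off the sectors symmetrisation CAN raise `τ_int`).  Setting:
`σ` a measure-preserving involution, `w ∘ σ = w`, and a proposal density `q` with `q ∘ σ = q` (e.g. the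
symmetrisation `q̃ₛ = ½(q̃ + q̃∘σ)` of any flow); `g` square-integrable with even / odd parts
`g₊ = ½(g + g∘σ)`, `g₋ = ½(g − g∘σ)`.

* `imhOp_comp_symm` — EQUIVARIANCE: `K_q(v ∘ σ)(x) = (K_q v)(σ x)` for every `v`; with the tree's
  homogeneity `imhOp_const_mul`, hence `imhOp_parity`, `imhOp_iterate_parity` — `K_qⁿ` preserves each parity
  (`v ∘ σ = c·v`, `c = ±1`);
* `integral_mul_mul_eq_zero_of_parity` — even and odd square-integrable functions are `w`-orthogonal;
* **`autocov_parity_split`** — `C_g(n) = C_{g₊}(n) + C_{g₋}(n)` for every lag `n` (in particular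
  `Var g = Var g₊ + Var g₋`);
* **`tauInt_parity_split`** — if `Var g₊, Var g₋ > 0` and both normalised series are summable, then the
  series of `g` is summable and `τ(g)·Var g = τ(g₊)·Var g₊ + τ(g₋)·Var g₋`: under a symmetric proposal
  `τ_int` of ANY observable is the variance-weighted mean of its parity components' `τ_int`;
* **`symmetrised_tauInt_le_parity_mix`** — consequently, for the SYMMETRISED flow `q̃ₛ` of ANY positive
  normalised `q̃`: if the RAW flow sampler's series for `g₊` and for `g₋` are summable, then
  `τ^{q̃ₛ}(g)·Var g ≤ τ^{q̃}(g₊)·Var g₊ + τ^{q̃}(g₋)·Var g₋` — symmetrisation never makes an observable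
  slower than the variance-weighted mean (a fortiori the maximum) of the raw flow's `τ_int` on its two
  parity components (gen-22's sector theorem applied to each part, then the split); dividing by
  `Var g = Var g₊ + Var g₋` this is `τ^{q̃ₛ}(g) ≤ max(τ^{q̃}(g₊), τ^{q̃}(g₋))`.

Nothing is cited as a fact.  NOT CLAIMED: `τ^{q̃ₛ}(g) ≤ τ^{q̃}(g)` for mixed-parity `g` (false in
general: the witness); anything for non-symmetric proposals beyond the last bullet; any value for any
network.
-/

namespace Summit.Ventures.LatticeQCDFlow.Exactness

open Real MeasureTheory Filter Finset Set Topology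
open Summit.Ventures.LatticeQCDFlow.Scoring

variable {X : Type*} [MeasurableSpace X] {μ : Measure X} [SFinite μ] {w q : X → ℝ} {σ : X → X}

/-! ## §1 Equivariance and parity preservation -/

omit [SFinite μ] in
/-- **EQUIVARIANCE**: for `w ∘ σ = w`, `q ∘ σ = q`, `σ` a measure-preserving involution,
`K_q(v ∘ σ)(x) = (K_q v)(σ x)` for every `v`. -/
theorem imhOp_comp_symm (hσ : MeasurePreserving σ μ μ) (hσσ : ∀ x, σ (σ x) = x)
    (hw : ∀ t, w (σ t) = w t) (hq : ∀ t, q (σ t) = q t) (v : X → ℝ) (x : X) :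
    imhOp μ w q (fun s => v (σ s)) x = imhOp μ w q v (σ x) := by
  unfold imhOp
  -- change variables `t' ↦ σ t'` on the left
  rw [← integral_comp_involution hσ hσσ
    (fun t' => (imhAcceptQ w q x t' * v (σ t') + (1 - imhAcceptQ w q x t') * v (σ x)) * q t')]
  refine integral_congr_ae (Eventually.of_forall fun t' => ?_)
  simp only [hσσ, hq, imhAcceptQ_comp_symm_right hw hq, imhAcceptQ_comp_symm_left hw hq]

omit [SFinite μ] in
/-- **`K_q` preserves parity**: `v ∘ σ = c·v` ⇒ `(K_q v) ∘ σ = c·(K_q v)`. -/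
theorem imhOp_parity (hσ : MeasurePreserving σ μ μ) (hσσ : ∀ x, σ (σ x) = x)
    (hw : ∀ t, w (σ t) = w t) (hq : ∀ t, q (σ t) = q t) {v : X → ℝ} {c : ℝ}
    (hv : ∀ x, v (σ x) = c * v x) (x : X) :
    imhOp μ w q v (σ x) = c * imhOp μ w q v x := by
  rw [← imhOp_comp_symm hσ hσσ hw hq v x]
  have e : (fun s => v (σ s)) = fun s => c * v s := funext hv
  rw [e, imhOp_const_mul]

omit [SFinite μ] in
/-- Iterates preserve parity: `(K_qⁿ v) ∘ σ = c·(K_qⁿ v)`. -/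
theorem imhOp_iterate_parity (hσ : MeasurePreserving σ μ μ) (hσσ : ∀ x, σ (σ x) = x)
    (hw : ∀ t, w (σ t) = w t) (hq : ∀ t, q (σ t) = q t) {v : X → ℝ} {c : ℝ}
    (hv : ∀ x, v (σ x) = c * v x) (n : ℕ) (x : X) :
    ((imhOp μ w q)^[n] v) (σ x) = c * ((imhOp μ w q)^[n] v) x := by
  induction n generalizing x with
  | zero => simpa using hv x
  | succ n ih =>
    rw [Function.iterate_succ_apply']
    exact imhOp_parity hσ hσσ hw hq (v := (imhOp μ w q)^[n] v) ih x

/-! ## §2 Orthogonality of the parities and the split of the autocovariances -/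

omit [SFinite μ] in
/-- **Even ⟂ odd in `L²(w)`**: `u ∘ σ = u`, `v ∘ σ = −v`, `w ∘ σ = w` ⇒ `∫ u v w = 0`. -/
theorem integral_mul_mul_eq_zero_of_parity (hσ : MeasurePreserving σ μ μ) (hσσ : ∀ x, σ (σ x) = x)
    (hw : ∀ t, w (σ t) = w t) {u v : X → ℝ} (hu : ∀ x, u (σ x) = u x)
    (hv : ∀ x, v (σ x) = -v x) : ∫ x, u x * v x * w x ∂μ = 0 := by
  have h := integral_comp_involution hσ hσσ (fun x => u x * v x * w x)
  have e : (fun x => u (σ x) * v (σ x) * w (σ x)) = fun x => -(u x * v x * w x) :=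
    funext fun x => by rw [hu, hv, hw]; ring
  rw [e, integral_neg] at h
  linarith

/-- **`C_g(n) = C_{g₊}(n) + C_{g₋}(n)`** for every lag, `g₊ = ½(g + g∘σ)`, `g₋ = ½(g − g∘σ)`,
`g` square-integrable, `w, q > 0` measurable integrable (`∫ q = 1`), `w ∘ σ = w`, `q ∘ σ = q`. -/
theorem autocov_parity_split (hσ : MeasurePreserving σ μ μ) (hσσ : ∀ x, σ (σ x) = x)
    (hw0 : ∀ t, 0 < w t) (hwm : Measurable w) (hwi : Integrable w μ) (hw : ∀ t, w (σ t) = w t)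
    (hq0 : ∀ t, 0 < q t) (hqm : Measurable q) (hqi : Integrable q μ) (hq1 : ∫ z, q z ∂μ = 1)
    (hq : ∀ t, q (σ t) = q t) {g : X → ℝ} (hgm : Measurable g)
    (hg2 : Integrable (fun t => g t ^ 2 * w t) μ) (n : ℕ) :
    ∫ x, g x * ((imhOp μ w q)^[n] g) x * w x ∂μ
      = ∫ x, (fun s => (g s + g (σ s)) / 2) x
            * ((imhOp μ w q)^[n] (fun s => (g s + g (σ s)) / 2)) x * w x ∂μ
        + ∫ x, (fun s => (g s - g (σ s)) / 2) x
            * ((imhOp μ w q)^[n] (fun s => (g s - g (σ s)) / 2)) x * w x ∂μ := by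
  -- the two parts are square-integrable, of parities `+1` and `−1`
  obtain ⟨hgσm, hgσ2⟩ := sqClass_comp_symm hσ hσσ hw hgm hg2
  have hA : Measurable g ∧ Integrable (fun t => g t ^ 2 * w t) μ := ⟨hgm, hg2⟩
  have hAσ : Measurable (fun s => g (σ s)) ∧ Integrable (fun t => g (σ t) ^ 2 * w t) μ := ⟨hgσm, hgσ2⟩
  have hplus : Measurable (fun s => (g s + g (σ s)) / 2)
      ∧ Integrable (fun t => ((g t + g (σ t)) / 2) ^ 2 * w t) μ := by
    have h1 := sqClass_comb hw0 hwm (1 : ℝ) hA hAσ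
    refine ⟨(hgm.add hgσm).div_const 2, ?_⟩
    have h2 := h1.2.const_mul (1 / 4)
    refine h2.congr (Eventually.of_forall fun t => ?_)
    show 1 / 4 * ((g t + 1 * g (σ t)) ^ 2 * w t) = ((g t + g (σ t)) / 2) ^ 2 * w t
    ring
  have hminus : Measurable (fun s => (g s - g (σ s)) / 2)
      ∧ Integrable (fun t => ((g t - g (σ t)) / 2) ^ 2 * w t) μ := by
    have h1 := sqClass_comb hw0 hwm (-1 : ℝ) hA hAσ
    refine ⟨(hgm.sub hgσm).div_const 2, ?_⟩
    have h2 := h1.2.const_mul (1 / 4)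
    refine h2.congr (Eventually.of_forall fun t => ?_)
    show 1 / 4 * ((g t + -1 * g (σ t)) ^ 2 * w t) = ((g t - g (σ t)) / 2) ^ 2 * w t
    ring
  have hpar_p : ∀ x, (fun s => (g s + g (σ s)) / 2) (σ x) = (1 : ℝ) * (fun s => (g s + g (σ s)) / 2) x :=
    fun x => by simp only [hσσ]; ring
  have hpar_m : ∀ x, (fun s => (g s - g (σ s)) / 2) (σ x) = (-1 : ℝ) * (fun s => (g s - g (σ s)) / 2) x :=
    fun x => by simp only [hσσ]; ring
  -- iterates of each part: square-integrable (stab) with the same parity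
  have hstab := sqClass_stab hw0 hwm hwi hq0 hqm hqi hq1
  have hlin := sqClass_lin hw0 hwm hwi hq0 hqm hqi
  have hiter : ∀ {v : X → ℝ}, (Measurable v ∧ Integrable (fun t => v t ^ 2 * w t) μ) →
      ∀ k, Measurable ((imhOp μ w q)^[k] v) ∧ Integrable (fun t => ((imhOp μ w q)^[k] v) t ^ 2 * w t) μ := by
    intro v hv k
    induction k with
    | zero => simpa using hv
    | succ k ih => rw [Function.iterate_succ']; exact hstab ih
  -- linearity of the iterates on the class: `Kⁿ(u + v) = Kⁿu + Kⁿv`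
  have hiter_add : ∀ k x, ((imhOp μ w q)^[k] g) x
      = ((imhOp μ w q)^[k] (fun s => (g s + g (σ s)) / 2)) x
        + ((imhOp μ w q)^[k] (fun s => (g s - g (σ s)) / 2)) x := by
    intro k
    induction k with
    | zero => intro x; simp only [Function.iterate_zero, id_eq]; ring
    | succ k ih =>
      intro x
      have e : (imhOp μ w q)^[k] g
          = fun s => ((imhOp μ w q)^[k] (fun s => (g s + g (σ s)) / 2)) s
            + 1 * ((imhOp μ w q)^[k] (fun s => (g s - g (σ s)) / 2)) s := funext fun s => by
        rw [ih s]; ring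
      rw [Function.iterate_succ_apply', Function.iterate_succ_apply', Function.iterate_succ_apply', e,
        hlin 1 (hiter hplus k) (hiter hminus k) x]
      ring
  -- expand `C_g(n)` and kill the cross terms by parity
  have hPe := hiter hplus n
  have hMe := hiter hminus n
  have hKp : ∀ x, ((imhOp μ w q)^[n] (fun s => (g s + g (σ s)) / 2)) (σ x)
      = ((imhOp μ w q)^[n] (fun s => (g s + g (σ s)) / 2)) x := fun x => by
    have h := imhOp_iterate_parity hσ hσσ hw hq (μ := μ) (v := fun s => (g s + g (σ s)) / 2)
      (c := 1) hpar_p n x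
    rw [h, one_mul]
  have hKm : ∀ x, ((imhOp μ w q)^[n] (fun s => (g s - g (σ s)) / 2)) (σ x)
      = -((imhOp μ w q)^[n] (fun s => (g s - g (σ s)) / 2)) x := fun x => by
    have h := imhOp_iterate_parity hσ hσσ hw hq (μ := μ) (v := fun s => (g s - g (σ s)) / 2)
      (c := -1) hpar_m n x
    rw [h]; ring
  have hp' : ∀ x, (fun s => (g s + g (σ s)) / 2) (σ x) = (fun s => (g s + g (σ s)) / 2) x :=
    fun x => by rw [hpar_p, one_mul]
  have hm' : ∀ x, (fun s => (g s - g (σ s)) / 2) (σ x) = -(fun s => (g s - g (σ s)) / 2) x :=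
    fun x => by rw [hpar_m]; ring
  have hcross1 : ∫ x, (fun s => (g s + g (σ s)) / 2) x
      * ((imhOp μ w q)^[n] (fun s => (g s - g (σ s)) / 2)) x * w x ∂μ = 0 :=
    integral_mul_mul_eq_zero_of_parity hσ hσσ hw hp' hKm
  have hcross2 : ∫ x, (fun s => (g s - g (σ s)) / 2) x
      * ((imhOp μ w q)^[n] (fun s => (g s + g (σ s)) / 2)) x * w x ∂μ = 0 := by
    have h := integral_mul_mul_eq_zero_of_parity hσ hσσ hw (μ := μ)
      (v := fun s => (g s - g (σ s)) / 2) hKp hm'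
    rw [← h]
    exact integral_congr_ae (Eventually.of_forall fun x => by ring)
  have I11 := sqClass_int hw0 hwm hplus hPe
  have I12 := sqClass_int hw0 hwm hplus hMe
  have I21 := sqClass_int hw0 hwm hminus hPe
  have I22 := sqClass_int hw0 hwm hminus hMe
  have e : ∀ x, g x * ((imhOp μ w q)^[n] g) x * w x
      = ((fun s => (g s + g (σ s)) / 2) x * ((imhOp μ w q)^[n] (fun s => (g s + g (σ s)) / 2)) x * w x
        + (fun s => (g s + g (σ s)) / 2) x * ((imhOp μ w q)^[n] (fun s => (g s - g (σ s)) / 2)) x * w x)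
        + ((fun s => (g s - g (σ s)) / 2) x * ((imhOp μ w q)^[n] (fun s => (g s + g (σ s)) / 2)) x * w x
        + (fun s => (g s - g (σ s)) / 2) x * ((imhOp μ w q)^[n] (fun s => (g s - g (σ s)) / 2)) x * w x) :=
    fun x => by
      rw [hiter_add n x]
      have hg : g x = (fun s => (g s + g (σ s)) / 2) x + (fun s => (g s - g (σ s)) / 2) x := by
        simp only []; ring
      rw [hg]
      ring
  have I1 : Integrable (fun x =>
      (fun s => (g s + g (σ s)) / 2) x * ((imhOp μ w q)^[n] (fun s => (g s + g (σ s)) / 2)) x * w x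
        + (fun s => (g s + g (σ s)) / 2) x * ((imhOp μ w q)^[n] (fun s => (g s - g (σ s)) / 2)) x * w x) μ :=
    I11.add I12
  have I2 : Integrable (fun x =>
      (fun s => (g s - g (σ s)) / 2) x * ((imhOp μ w q)^[n] (fun s => (g s + g (σ s)) / 2)) x * w x
        + (fun s => (g s - g (σ s)) / 2) x * ((imhOp μ w q)^[n] (fun s => (g s - g (σ s)) / 2)) x * w x) μ :=
    I21.add I22
  rw [integral_congr_ae (Eventually.of_forall e), integral_add I1 I2, integral_add I11 I12,
    integral_add I21 I22, hcross1, hcross2]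
  ring

/-! ## §3 `τ_int` of any observable is the variance-weighted mean of its parity components' -/

/-- **`τ(g)·Var g = τ(g₊)·Var g₊ + τ(g₋)·Var g₋` under a symmetric proposal.**  With
`P₊ = ∫ g₊² w > 0`, `P₋ = ∫ g₋² w > 0` and both normalised autocorrelation series summable, the series
of `g` (normalised by `∫ g² w = P₊ + P₋`) is summable and the identity holds. -/
theorem tauInt_parity_split (hσ : MeasurePreserving σ μ μ) (hσσ : ∀ x, σ (σ x) = x)
    (hw0 : ∀ t, 0 < w t) (hwm : Measurable w) (hwi : Integrable w μ) (hw : ∀ t, w (σ t) = w t)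
    (hq0 : ∀ t, 0 < q t) (hqm : Measurable q) (hqi : Integrable q μ) (hq1 : ∫ z, q z ∂μ = 1)
    (hq : ∀ t, q (σ t) = q t) {g : X → ℝ} (hgm : Measurable g)
    (hg2 : Integrable (fun t => g t ^ 2 * w t) μ)
    (hPp : 0 < ∫ x, ((g x + g (σ x)) / 2) ^ 2 * w x ∂μ)
    (hPm : 0 < ∫ x, ((g x - g (σ x)) / 2) ^ 2 * w x ∂μ)
    (hsp : Summable fun n => (∫ x, (fun s => (g s + g (σ s)) / 2) x
        * ((imhOp μ w q)^[n + 1] (fun s => (g s + g (σ s)) / 2)) x * w x ∂μ)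
        / ∫ x, ((g x + g (σ x)) / 2) ^ 2 * w x ∂μ)
    (hsm : Summable fun n => (∫ x, (fun s => (g s - g (σ s)) / 2) x
        * ((imhOp μ w q)^[n + 1] (fun s => (g s - g (σ s)) / 2)) x * w x ∂μ)
        / ∫ x, ((g x - g (σ x)) / 2) ^ 2 * w x ∂μ) :
    (∫ x, g x ^ 2 * w x ∂μ
        = (∫ x, ((g x + g (σ x)) / 2) ^ 2 * w x ∂μ) + ∫ x, ((g x - g (σ x)) / 2) ^ 2 * w x ∂μ) ∧
    (Summable fun n => (∫ x, g x * ((imhOp μ w q)^[n + 1] g) x * w x ∂μ) / ∫ x, g x ^ 2 * w x ∂μ) ∧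
    tauInt (fun n => (∫ x, g x * ((imhOp μ w q)^[n] g) x * w x ∂μ) / ∫ x, g x ^ 2 * w x ∂μ)
        * ∫ x, g x ^ 2 * w x ∂μ
      = tauInt (fun n => (∫ x, (fun s => (g s + g (σ s)) / 2) x
            * ((imhOp μ w q)^[n] (fun s => (g s + g (σ s)) / 2)) x * w x ∂μ)
            / ∫ x, ((g x + g (σ x)) / 2) ^ 2 * w x ∂μ) * ∫ x, ((g x + g (σ x)) / 2) ^ 2 * w x ∂μ
        + tauInt (fun n => (∫ x, (fun s => (g s - g (σ s)) / 2) x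
            * ((imhOp μ w q)^[n] (fun s => (g s - g (σ s)) / 2)) x * w x ∂μ)
            / ∫ x, ((g x - g (σ x)) / 2) ^ 2 * w x ∂μ) * ∫ x, ((g x - g (σ x)) / 2) ^ 2 * w x ∂μ := by
  have hsplit := fun n => autocov_parity_split hσ hσσ hw0 hwm hwi hw hq0 hqm hqi hq1 hq hgm hg2 n
  -- lag 0: the variance split
  set Pp := ∫ x, ((g x + g (σ x)) / 2) ^ 2 * w x ∂μ with hPpdef
  set Pm := ∫ x, ((g x - g (σ x)) / 2) ^ 2 * w x ∂μ with hPmdef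
  set P := ∫ x, g x ^ 2 * w x ∂μ with hPdef
  set Cp : ℕ → ℝ := fun n => ∫ x, (fun s => (g s + g (σ s)) / 2) x
      * ((imhOp μ w q)^[n] (fun s => (g s + g (σ s)) / 2)) x * w x ∂μ with hCp
  set Cm : ℕ → ℝ := fun n => ∫ x, (fun s => (g s - g (σ s)) / 2) x
      * ((imhOp μ w q)^[n] (fun s => (g s - g (σ s)) / 2)) x * w x ∂μ with hCm
  set C : ℕ → ℝ := fun n => ∫ x, g x * ((imhOp μ w q)^[n] g) x * w x ∂μ with hC
  have hC0 : C 0 = P := by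
    simp only [hC, hPdef, Function.iterate_zero, id_eq]
    exact integral_congr_ae (Eventually.of_forall fun x => by ring)
  have hCp0 : Cp 0 = Pp := by
    simp only [hCp, hPpdef, Function.iterate_zero, id_eq]
    exact integral_congr_ae (Eventually.of_forall fun x => by ring)
  have hCm0 : Cm 0 = Pm := by
    simp only [hCm, hPmdef, Function.iterate_zero, id_eq]
    exact integral_congr_ae (Eventually.of_forall fun x => by ring)
  have hPsplit : P = Pp + Pm := by rw [← hC0, ← hCp0, ← hCm0]; exact hsplit 0
  have hP : 0 < P := by rw [hPsplit]; exact add_pos hPp hPm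
  -- unnormalised series
  have hsp' : Summable fun n => Cp (n + 1) := by
    have h := hsp.mul_left Pp
    refine h.congr fun n => ?_
    show Pp * (Cp (n + 1) / Pp) = Cp (n + 1)
    field_simp
  have hsm' : Summable fun n => Cm (n + 1) := by
    have h := hsm.mul_left Pm
    refine h.congr fun n => ?_
    show Pm * (Cm (n + 1) / Pm) = Cm (n + 1)
    field_simp
  have hsum' : Summable fun n => C (n + 1) := by
    refine (hsp'.add hsm').congr fun n => ?_
    show Cp (n + 1) + Cm (n + 1) = C (n + 1)
    exact (hsplit (n + 1)).symm
  have hsum : Summable fun n => C (n + 1) / P := by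
    refine (hsum'.mul_left (1 / P)).congr fun n => ?_
    show 1 / P * C (n + 1) = C (n + 1) / P
    ring
  refine ⟨hPsplit, hsum, ?_⟩
  -- `τ·P = P/2 + Σ C(n+1)`, and the same for each part
  have key : ∀ {D : ℕ → ℝ} {R : ℝ}, 0 < R → (Summable fun n => D (n + 1)) →
      tauInt (fun n => D n / R) * R = R / 2 + ∑' n, D (n + 1) := by
    intro D R hR hD
    unfold tauInt
    have e : ∑' n, D (n + 1) / R = (∑' n, D (n + 1)) / R := by
      rw [← tsum_div_const]
    rw [e]
    field_simp
  have hts : ∑' n, C (n + 1) = (∑' n, Cp (n + 1)) + ∑' n, Cm (n + 1) := by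
    rw [← hsp'.tsum_add hsm']
    exact tsum_congr fun n => hsplit (n + 1)
  rw [key hP hsum', key hPp hsp', key hPm hsm', hts, hPsplit]
  ring

/-! ## §4 The symmetrised flow versus the raw flow, for ANY observable -/

/-- **SYMMETRISATION NEVER MAKES AN OBSERVABLE SLOWER THAN THE RAW FLOW'S PARITY COMPONENTS OF IT.**
`σ` a measure-preserving involution, `w ∘ σ = w`; `q̃ > 0` measurable integrable normalised (NO
symmetry assumed), `q̃ₛ = ½(q̃ + q̃∘σ)`; `g` square-integrable with `Var g₊, Var g₋ > 0`; the RAW flow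
sampler's normalised series for `g₊` and for `g₋` summable.  Then under the SYMMETRISED sampler the
series of `g` is summable and
`τ^{q̃ₛ}(g)·Var g ≤ τ^{q̃}(g₊)·Var g₊ + τ^{q̃}(g₋)·Var g₋` (`Var g = Var g₊ + Var g₋`). -/
theorem symmetrised_tauInt_le_parity_mix (hσ : MeasurePreserving σ μ μ) (hσσ : ∀ x, σ (σ x) = x)
    (hw0 : ∀ t, 0 < w t) (hwm : Measurable w) (hwi : Integrable w μ) (hw : ∀ t, w (σ t) = w t)
    (hq0 : ∀ t, 0 < q t) (hqm : Measurable q) (hqi : Integrable q μ) (hq1 : ∫ z, q z ∂μ = 1)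
    {g : X → ℝ} (hgm : Measurable g) (hg2 : Integrable (fun t => g t ^ 2 * w t) μ)
    (hPp : 0 < ∫ x, ((g x + g (σ x)) / 2) ^ 2 * w x ∂μ)
    (hPm : 0 < ∫ x, ((g x - g (σ x)) / 2) ^ 2 * w x ∂μ)
    (hsp : Summable fun n => (∫ x, (fun s => (g s + g (σ s)) / 2) x
        * ((imhOp μ w q)^[n + 1] (fun s => (g s + g (σ s)) / 2)) x * w x ∂μ)
        / ∫ x, ((g x + g (σ x)) / 2) ^ 2 * w x ∂μ)
    (hsm : Summable fun n => (∫ x, (fun s => (g s - g (σ s)) / 2) x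
        * ((imhOp μ w q)^[n + 1] (fun s => (g s - g (σ s)) / 2)) x * w x ∂μ)
        / ∫ x, ((g x - g (σ x)) / 2) ^ 2 * w x ∂μ) :
    (Summable fun n => (∫ x, g x * ((imhOp μ w (fun s => (q s + q (σ s)) / 2))^[n + 1] g) x * w x ∂μ)
        / ∫ x, g x ^ 2 * w x ∂μ) ∧
    tauInt (fun n => (∫ x, g x * ((imhOp μ w (fun s => (q s + q (σ s)) / 2))^[n] g) x * w x ∂μ)
        / ∫ x, g x ^ 2 * w x ∂μ) * ∫ x, g x ^ 2 * w x ∂μ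
      ≤ tauInt (fun n => (∫ x, (fun s => (g s + g (σ s)) / 2) x
            * ((imhOp μ w q)^[n] (fun s => (g s + g (σ s)) / 2)) x * w x ∂μ)
            / ∫ x, ((g x + g (σ x)) / 2) ^ 2 * w x ∂μ) * ∫ x, ((g x + g (σ x)) / 2) ^ 2 * w x ∂μ
        + tauInt (fun n => (∫ x, (fun s => (g s - g (σ s)) / 2) x
            * ((imhOp μ w q)^[n] (fun s => (g s - g (σ s)) / 2)) x * w x ∂μ)
            / ∫ x, ((g x - g (σ x)) / 2) ^ 2 * w x ∂μ) * ∫ x, ((g x - g (σ x)) / 2) ^ 2 * w x ∂μ := by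
  obtain ⟨hs0, hsmeas, hsi, hs1, hssym⟩ := symmetrised_facts hσ hσσ hq0 hqm hqi hq1
  obtain ⟨hgσm, hgσ2⟩ := sqClass_comp_symm hσ hσσ hw hgm hg2
  have hA : Measurable g ∧ Integrable (fun t => g t ^ 2 * w t) μ := ⟨hgm, hg2⟩
  have hAσ : Measurable (fun s => g (σ s)) ∧ Integrable (fun t => g (σ t) ^ 2 * w t) μ := ⟨hgσm, hgσ2⟩
  -- the parity parts are square-integrable, even resp. odd
  have hplus : Measurable (fun s => (g s + g (σ s)) / 2)
      ∧ Integrable (fun t => ((g t + g (σ t)) / 2) ^ 2 * w t) μ := by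
    have h1 := sqClass_comb hw0 hwm (1 : ℝ) hA hAσ
    refine ⟨(hgm.add hgσm).div_const 2, (h1.2.const_mul (1 / 4)).congr
      (Eventually.of_forall fun t => ?_)⟩
    show 1 / 4 * ((g t + 1 * g (σ t)) ^ 2 * w t) = ((g t + g (σ t)) / 2) ^ 2 * w t
    ring
  have hminus : Measurable (fun s => (g s - g (σ s)) / 2)
      ∧ Integrable (fun t => ((g t - g (σ t)) / 2) ^ 2 * w t) μ := by
    have h1 := sqClass_comb hw0 hwm (-1 : ℝ) hA hAσ
    refine ⟨(hgm.sub hgσm).div_const 2, (h1.2.const_mul (1 / 4)).congr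
      (Eventually.of_forall fun t => ?_)⟩
    show 1 / 4 * ((g t + -1 * g (σ t)) ^ 2 * w t) = ((g t - g (σ t)) / 2) ^ 2 * w t
    ring
  have hpar_p : ∀ x, (fun s => (g s + g (σ s)) / 2) (σ x) = (1 : ℝ) * (fun s => (g s + g (σ s)) / 2) x :=
    fun x => by simp only [hσσ]; ring
  have hpar_m : ∀ x, (fun s => (g s - g (σ s)) / 2) (σ x) = (-1 : ℝ) * (fun s => (g s - g (σ s)) / 2) x :=
    fun x => by simp only [hσσ]; ring
  -- gen-22's parity theorem for each part
  obtain ⟨hsSp, hτp⟩ := symmetrised_tauInt_le_of_parity hσ hσσ hw0 hwm hwi hw hq0 hqm hqi hq1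
    hplus.1 hplus.2 hPp (c := 1) (by norm_num) hpar_p hsp
  obtain ⟨hsSm, hτm⟩ := symmetrised_tauInt_le_of_parity hσ hσσ hw0 hwm hwi hw hq0 hqm hqi hq1
    hminus.1 hminus.2 hPm (c := -1) (by norm_num) hpar_m hsm
  -- the split under the (symmetric) proposal `q̃ₛ`
  obtain ⟨-, hsum, heq⟩ := tauInt_parity_split hσ hσσ hw0 hwm hwi hw hs0 hsmeas hsi hs1 hssym hgm hg2
    hPp hPm hsSp hsSm
  refine ⟨hsum, ?_⟩
  rw [heq]
  have h1 := mul_le_mul_of_nonneg_right hτp hPp.le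
  have h2 := mul_le_mul_of_nonneg_right hτm hPm.le
  linarith

end Summit.Ventures.LatticeQCDFlow.Exactness
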